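import Summits.NavierStokesRegularity.NavierStokesRegularity.Theorems.EfficiencyFloorEnstrophyBudget
import Summits.NavierStokesRegularity.NavierStokesRegularity.Theorems.EfficiencyFloorProductionEfficiencyDecayIntegrateEfficiency
import Summits.NavierStokesRegularity.NavierStokesRegularity.Theses.EfficiencyFloor
import HarnessLib

/-!
# Crux `EfficiencyFloor.ProductionEfficiencyDecay` (stmt-NavierStokesRegularity-22866) is EQUIVALENT to its
# registered crux-proper stub `stub_depletionGivenBudget` (pointwise efficiency decay) — the skeleton loses nothing

`--supports stmt-NavierStokesRegularity-22866 --as helper` (lead of line `efficiency_floor`).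

With the enstrophy budget (`EnstrophyBudget.main`, stmt-22995, landed) and the integration step
(`ProductionEfficiencyDecay.stub_integrateEfficiency`, landed) the registered skeleton proves the crux from the single
open stub S2 = `stub_depletionGivenBudget` (signature verbatim below as a hypothesis):
`productionEfficiencyDecay_of_depletion`. Conversely the crux IMPLIES S2 (`depletion_of_productionEfficiencyDecay`):
on the window of the every-subinterval law `Z(s)⁻² − Z(t)⁻² ≤ ε(t−s)` the right slopes of `g = Z⁻²` are `≥ −ε`,
and `g' = −2Ż/Z³` (budget), so `Ż = 2S − 2ν·Pal ≤ (ε/2) Z³ ≤ ε Z³`. Hence S2 ⟺ crux: the line's decomposition is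
tight (S2 is not a strengthening), and the crux is exactly 'the Lu–Doering efficiency `Ż/Z³` tends to zero
pointwise at every blow-up' — open-problem grade, as filed.

Nothing about NS regularity is asserted; the crux is NOT proved here. [folklore]
-/

-- the problem directory repeats the summit name (`NavierStokesRegularity/NavierStokesRegularity`)
set_option linter.dupNamespace false

noncomputable section

open Set Filter MeasureTheory Topology
open scoped InnerProductSpace ENNReal NNReal
open Literature.Analysis.FluidPDE

namespace Summit.NavierStokesRegularity.NavierStokesRegularity.Theorems

namespace ProductionEfficiencyDecay

/-- **Skeleton composition with S2 as a hypothesis**: the registered crux-proper stub `stub_depletionGivenBudget`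
(verbatim) implies the crux, through the landed budget (S1) and integration (S3) stubs. [folklore] -/
theorem productionEfficiencyDecay_of_depletion
    (hS2 : ∀ (c ν T : ℝ), 0 < c → 0 < ν → 0 < T → ∀ (u : ℝ → EuclideanSpace ℝ (Fin 3) → EuclideanSpace ℝ (Fin 3)) (p : ℝ → EuclideanSpace ℝ (Fin 3) → ℝ), Literature.Analysis.FluidPDE.IsMaximalSmoothSolution ν 0 u p T → Literature.Analysis.FluidPDE.IsLerayHopfOn T ν 0 (u 0) u → Literature.Analysis.FluidPDE.HasRapidSpatialDecay (u 0) → ∀ (Zr Pr Sr : ℝ → ℝ), (∀ t ∈ Set.Ioo 0 T, ∫⁻ x, ‖Literature.Analysis.FluidPDE.curl (u t) x‖ₑ ^ 2 = ENNReal.ofReal (Zr t) ∧ 0 ≤ Zr t ∧ 0 ≤ Pr t ∧ Pr t = ∫ x, Literature.Analysis.FluidPDE.frobeniusNormSq (fderiv ℝ (Literature.Analysis.FluidPDE.curl (u t)) x) ∧ Sr t = ∫ x, ⟪Literature.Analysis.FluidPDE.curl (u t) x, fderiv ℝ (u t) x (Literature.Analysis.FluidPDE.curl (u t) x)⟫_ℝ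 ∧ HasDerivAt Zr (2 * Sr t - 2 * ν * Pr t) t ∧ |Sr t| ≤ c * Zr t ^ (3/4 : ℝ) * Pr t ^ (3/4 : ℝ)) → ∀ ε : ℝ, 0 < ε → ∃ t₁ ∈ Set.Ioo 0 T, ∀ t ∈ Set.Ico t₁ T, 0 < Zr t ∧ 2 * Sr t - 2 * ν * Pr t ≤ ε * Zr t ^ 3) :
    Summit.NavierStokesRegularity.NavierStokesRegularity.Theses.EfficiencyFloor.ProductionEfficiencyDecay := by
  unfold Summit.NavierStokesRegularity.NavierStokesRegularity.Theses.EfficiencyFloor.ProductionEfficiencyDecay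
  intro ν T hν hT u p hmax hLH hdec ε hε
  obtain ⟨c, hc, hB⟩ := EnstrophyBudget.main
  obtain ⟨Zr, Pr, Sr, hZ⟩ := hB ν T hν hT u p hmax hLH hdec
  obtain ⟨t₁, ht₁, hdep⟩ := hS2 c ν T hc hν hT u p hmax hLH hdec Zr Pr Sr hZ (ε / 2) (half_pos hε)
  have hIoo : ∀ t ∈ Ico t₁ T, t ∈ Ioo 0 T := fun t ht => ⟨ht₁.1.trans_le ht.1, ht.2⟩
  have hpos : ∀ t ∈ Ico t₁ T, 0 < Zr t := fun t ht => (hdep t ht).1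
  have hder : ∀ t ∈ Ico t₁ T, ∃ D : ℝ, HasDerivAt Zr D t ∧ D ≤ ε / 2 * Zr t ^ 3 := fun t ht =>
    ⟨2 * Sr t - 2 * ν * Pr t, (hZ t (hIoo t ht)).2.2.2.2.2.1, (hdep t ht).2⟩
  refine ⟨t₁, ⟨ht₁.1.le, ht₁.2⟩, fun t ht => ?_, fun s t hs hst htT => ?_⟩
  · rw [(hZ t (hIoo t ht)).1]
    exact ⟨ENNReal.ofReal_pos.2 (hpos t ht), ENNReal.ofReal_lt_top⟩
  · have hsI : s ∈ Ico t₁ T := ⟨hs, hst.trans_lt htT⟩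
    have htI : t ∈ Ico t₁ T := ⟨hs.trans hst, htT⟩
    rw [(hZ s (hIoo s hsI)).1, (hZ t (hIoo t htI)).1, ENNReal.toReal_ofReal (hpos s hsI).le,
      ENNReal.toReal_ofReal (hpos t htI).le]
    have h := stub_integrateEfficiency Zr t₁ T (ε / 2) hpos hder s t hs hst htT
    linarith

/-- **The crux implies S2** (so S2 ⟺ crux): on the window of the every-subinterval law the right slopes of
`g = Z⁻²` are `≥ −ε`; with `g' = −2Ż/Z³` from the budget, `Ż = 2S − 2ν·Pal ≤ (ε/2)Z³ ≤ εZ³`. [folklore] -/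
theorem depletion_of_productionEfficiencyDecay
    (hE : Summit.NavierStokesRegularity.NavierStokesRegularity.Theses.EfficiencyFloor.ProductionEfficiencyDecay) :
    ∀ (c ν T : ℝ), 0 < c → 0 < ν → 0 < T → ∀ (u : ℝ → EuclideanSpace ℝ (Fin 3) → EuclideanSpace ℝ (Fin 3)) (p : ℝ → EuclideanSpace ℝ (Fin 3) → ℝ), Literature.Analysis.FluidPDE.IsMaximalSmoothSolution ν 0 u p T → Literature.Analysis.FluidPDE.IsLerayHopfOn T ν 0 (u 0) u → Literature.Analysis.FluidPDE.HasRapidSpatialDecay (u 0) → ∀ (Zr Pr Sr : ℝ → ℝ), (∀ t ∈ Set.Ioo 0 T, ∫⁻ x, ‖Literature.Analysis.FluidPDE.curl (u t) x‖ₑ ^ 2 = ENNReal.ofReal (Zr t) ∧ 0 ≤ Zr t ∧ 0 ≤ Pr t ∧ Pr t = ∫ x, Literature.Analysis.FluidPDE.frobeniusNormSq (fderiv ℝ (Literature.Analysis.FluidPDE.curl (u t)) x) ∧ Sr t = ∫ x, ⟪Literature.Analysis.FluidPDE.curl (u t) x, fderiv ℝ (u t) x (Literature.Analysis.FluidPDE.curl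 (u t) x)⟫_ℝ ∧ HasDerivAt Zr (2 * Sr t - 2 * ν * Pr t) t ∧ |Sr t| ≤ c * Zr t ^ (3/4 : ℝ) * Pr t ^ (3/4 : ℝ)) → ∀ ε : ℝ, 0 < ε → ∃ t₁ ∈ Set.Ioo 0 T, ∀ t ∈ Set.Ico t₁ T, 0 < Zr t ∧ 2 * Sr t - 2 * ν * Pr t ≤ ε * Zr t ^ 3 := by
  intro c ν T hc hν hT u p hmax hLH hdec Zr Pr Sr hZ ε hε
  obtain ⟨t₁, ht₁, hwin, hlaw⟩ := hE ν T hν hT u p hmax hLH hdec ε hε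
  -- a window start in the OPEN interval
  set t₂ : ℝ := (t₁ + T) / 2 with ht₂
  have ht₂I : t₂ ∈ Ioo 0 T := ⟨by rw [ht₂]; linarith [ht₁.1, ht₁.2], by rw [ht₂]; linarith [ht₁.2]⟩
  have ht₁₂ : t₁ ≤ t₂ := by rw [ht₂]; linarith [ht₁.2]
  refine ⟨t₂, ht₂I, fun t ht => ?_⟩
  have htI : t ∈ Ioo 0 T := ⟨ht₂I.1.trans_le ht.1, ht.2⟩
  have ht1I : t ∈ Ico t₁ T := ⟨ht₁₂.trans ht.1, ht.2⟩
  -- real values: on `(0,T)` the lintegral enstrophy is `ofReal (Zr ·)`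
  have hreal : ∀ s ∈ Ioo 0 T, (∫⁻ x, ‖curl (u s) x‖ₑ ^ 2).toReal = Zr s := fun s hs => by
    rw [(hZ s hs).1, ENNReal.toReal_ofReal (hZ s hs).2.1]
  obtain ⟨hZeq, -, -, -, -, hD, -⟩ := hZ t htI
  have hZt : 0 < Zr t := by
    have h := (hwin t ht1I).1
    rw [hZeq, ENNReal.ofReal_pos] at h
    exact h
  refine ⟨hZt, ?_⟩
  -- the derivative of `G = Zr⁻²` at `t` and its right slopes
  set D : ℝ := 2 * Sr t - 2 * ν * Pr t with hDdef
  set G : ℝ → ℝ := fun r => (Zr r)⁻¹ ^ 2 with hG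
  have hGd : HasDerivAt G (-2 * D / Zr t ^ 3) t := hasDerivAt_inv_sq hD hZt.ne'
  have htend : Tendsto (slope G t) (𝓝[>] t) (𝓝 (-2 * D / Zr t ^ 3)) :=
    (hasDerivWithinAt_iff_tendsto_slope' (show t ∉ Ioi t from lt_irrefl t)).1 hGd.hasDerivWithinAt
  have hslope : ∀ᶠ s in 𝓝[>] t, -ε ≤ slope G t s := by
    filter_upwards [Ioo_mem_nhdsGT htI.2] with s hs
    have hsI : s ∈ Ioo 0 T := ⟨htI.1.trans hs.1, hs.2⟩
    have hl := hlaw t s ht1I.1 hs.1.le hs.2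
    rw [hreal t htI, hreal s hsI] at hl
    -- `hl : G t - G s ≤ ε (s - t)`
    rw [slope_def_field]
    have hst : 0 < s - t := sub_pos.2 hs.1
    rw [le_div_iff₀ hst]
    show -ε * (s - t) ≤ G s - G t
    simp only [hG]
    linarith
  have hlim : -ε ≤ -2 * D / Zr t ^ 3 := ge_of_tendsto htend hslope
  -- `D ≤ (ε/2) Z³ ≤ ε Z³`
  have hZ3 : 0 < Zr t ^ 3 := pow_pos hZt 3
  have h1 : 2 * D ≤ ε * Zr t ^ 3 := by
    have h2 : -ε * Zr t ^ 3 ≤ -2 * D := by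
      have := mul_le_mul_of_nonneg_right hlim hZ3.le
      rwa [div_mul_cancel₀ _ hZ3.ne'] at this
    linarith
  have hεZ : 0 ≤ ε * Zr t ^ 3 := mul_nonneg hε.le hZ3.le
  show D ≤ ε * Zr t ^ 3
  linarith

end ProductionEfficiencyDecay

end Summit.NavierStokesRegularity.NavierStokesRegularity.Theorems

end
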